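import Summits.KontsevichZagierPeriods.Zeta5Search.LaiSweepShard

/-!
# `κ₃` sweep certificate — shard file 070 of 127 (shards 490–496 of 889)

HONEST FRAMING. Systematic search; no irrationality claim unless certified. This file only checks,
by `decide +kernel`, shards 490–496 of the order-cell sweep of the `κ₃` point `(74, 2180, 444; δ74)`
(engine `LaiSweepEngine`, soundness `LaiSweepJump/Free/Eval/Shard/Kappa3`; a shard is `⟨regime, n,
p, q, p', q', Lo, Up⟩`: `n` cells from `p/q` to `p'/q'` with integer rate sums in `[Lo, Up]`, `K =
128`, `D = 2^40`). It draws NO conclusion: only the capstone `LaiKappa3SweepCert`, which needs all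
127 shard files, does. Kernel cost of this file ≈ 560 cells × 0.3 s.
-/

namespace Summit.KontsevichZagierPeriods.Zeta5Search.Sweep

set_option maxHeartbeats 100000000 in
/-- Shard 490: 80 cells of regime B from `128/257` to `204/409`.
[cite: Lai2024BallRivoal, §4 Lemma 4.3] -/
theorem shard490 :
    Shard.check 128 (2^40)
      ⟨true, 80, 128, 257, 204, 409, 8632146245173, 10499774631439⟩ = true := by
  decide +kernel

set_option maxHeartbeats 100000000 in
/-- Shard 491: 80 cells of regime B from `204/409` to `169/337`.
[cite: Lai2024BallRivoal, §4 Lemma 4.3] -/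
theorem shard491 :
    Shard.check 128 (2^40)
      ⟨true, 80, 204, 409, 169, 337, 32109314983719, 39114839215650⟩ = true := by
  decide +kernel

set_option maxHeartbeats 100000000 in
/-- Shard 492: 80 cells of regime B from `169/337` to `102/203`.
[cite: Lai2024BallRivoal, §4 Lemma 4.3] -/
theorem shard492 :
    Shard.check 128 (2^40)
      ⟨true, 80, 169, 337, 102, 203, 11553444711263, 14090673406354⟩ = true := by
  decide +kernel

set_option maxHeartbeats 100000000 in
/-- Shard 493: 80 cells of regime B from `102/203` to `139/276`.
[cite: Lai2024BallRivoal, §4 Lemma 4.3] -/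
theorem shard493 :
    Shard.check 128 (2^40)
      ⟨true, 80, 102, 203, 139, 276, 13806749990382, 16852424213660⟩ = true := by
  decide +kernel

set_option maxHeartbeats 100000000 in
/-- Shard 494: 80 cells of regime B from `139/276` to `157/311`.
[cite: Lai2024BallRivoal, §4 Lemma 4.3] -/
theorem shard494 :
    Shard.check 128 (2^40)
      ⟨true, 80, 139, 276, 157, 311, 14204194780064, 17352943011255⟩ = true := by
  decide +kernel

set_option maxHeartbeats 100000000 in
/-- Shard 495: 80 cells of regime B from `157/311` to `167/330`.
[cite: Lai2024BallRivoal, §4 Lemma 4.3] -/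
theorem shard495 :
    Shard.check 128 (2^40)
      ⟨true, 80, 157, 311, 167, 330, 14630003082841, 17889614470946⟩ = true := by
  decide +kernel

set_option maxHeartbeats 100000000 in
/-- Shard 496: 80 cells of regime B from `167/330` to `174/343`.
[cite: Lai2024BallRivoal, §4 Lemma 4.3] -/
theorem shard496 :
    Shard.check 128 (2^40)
      ⟨true, 80, 167, 330, 174, 343, 14507629818888, 17756465171669⟩ = true := by
  decide +kernel

/-- The checked shards of this file, in order. [folklore] -/
def shards070 : List (CheckedShard 128 (2^40)) :=
  [⟨_, shard490⟩, ⟨_, shard491⟩, ⟨_, shard492⟩, ⟨_, shard493⟩, ⟨_, shard494⟩,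
    ⟨_, shard495⟩, ⟨_, shard496⟩]

end Summit.KontsevichZagierPeriods.Zeta5Search.Sweep
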